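import Summits.BirchSwinnertonDyer.BirchSwinnertonDyer.Theorems.QuadraticBranchSignedControlPlusEtaNonsurjTamagawaSplitPartner
import Summits.BirchSwinnertonDyer.BirchSwinnertonDyer.Theorems.QuadraticBranchSignedControlPlusEtaNonsurjTamagawaSplit
import Summits.BirchSwinnertonDyer.BirchSwinnertonDyer.Theorems.QuadraticBranchSignedControlPlusEtaNonsurjMultiplicativeCongruence
import Summits.BirchSwinnertonDyer.Rank1Residual.AdditivePotMult.QuadraticTwistTamagawaMultiplicative
import Literature.NumberTheory.EllipticCurves.BSDSelmerSkinnerThmBProofs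
import Literature.NumberTheory.EllipticCurves.PAdicBSDSplitMultiplicativeProofs
import HarnessLib

/-!
# Route `QuadraticBranchSignedControl` (rung K8, cell `bsd-potss`): crux stmt-BirchSwinnertonDyer-19606
# `PlusEtaMainConjectureNonsurj` — THE SPLITTING LAW OF THE ADDITIVE PARTNER: at a multiplicative prime `ℓ ≠ p` of a row
# `V = C • W^{(p*)}`, `W` is split iff (`V` is split ⟺ (`ℓ ≡ 1 (mod p)` or `p ≡ 1 (mod 4)`)); hence `p ∣ c_ℓ(W) ⟺ p ∣ c_ℓ(V)`
# when `p ≡ 1 (mod 4)`, and at an inert `ℓ` (`ℓ ≡ −1`) with `p ≡ 3 (mod 4)` exactly one of `c_ℓ(V)`, `c_ℓ(W)` is divisible by `p`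

WHAT. Companion of `…PlusEtaNonsurjTamagawaSplit` / `…TamagawaSplitPartner` (Tamagawa laws of a row `V` and of its globally minimal
additive partner `W`, `C • W^{(p*)} = V`, `p* = (−1)^{⌊p/2⌋} p`, now EQUIVALENCES: `p ∣ c_v ⟺ v` split multiplicative) and of
`…MultiplicativeCongruence` (every multiplicative `ℓ ≠ p` of a row is `≡ ±1 (mod p)`). The twist by `p*` is unramified at `ℓ`, so `W` is
multiplicative at `ℓ` iff `V` is (`Additive.mult_iff_of_twist_pStar`), and its splitting type is governed by the Legendre symbol
`(p*/ℓ) = (ℓ/p)` (Silverman *AEC* X.2 / Ex. 10.16 — the cell's `AdditivePotMult.hasMultiplicativeReductionAt_and_split_iff_quadraticTwist_of_not_dvd`;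
quadratic reciprocity with the first supplement — the tree's `legendreSym_pStar`):

* §8 `hasSplitMultiplicativeReductionAtPrime_iff_legendreSym_iff_of_twist_pStar` — for ANY globally minimal elliptic `W/ℚ`, odd `p`, odd
  `ℓ ≠ p` multiplicative for `W`, and `C • W^{(p*)} = V`: **`V` split at `ℓ` ⟺ ((ℓ/p) = 1 ⟺ `W` split at `ℓ`)**.
* §9 on a ROW of crux 19606 (`ℓ ≡ ±1 (mod p)`): `legendreSym_eq_one_iff_of_hasMultiplicativeReduction_of_row` — `(ℓ/p) = 1 ⟺ (ℓ ≡ 1 (mod p) ∨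
  p ≡ 1 (mod 4))`; **`hasSplitMultiplicativeReductionAtPrime_partner_iff_of_row`** — `W` split at `ℓ` ⟺ (`V` split at `ℓ` ⟺ (`ℓ ≡ 1 (mod p)`
  ∨ `p ≡ 1 (mod 4)`)); `…_of_one_mod_four_of_row` (`p ≡ 1 (4)`: `W` split ⟺ `V` split), `…_of_three_mod_four_of_natCast_eq_neg_one_of_row`
  (`p ≡ 3 (4)`, `ℓ ≡ −1`: `W` split ⟺ `V` NOT split).
* §10 TAMAGAWA: **`dvd_localTamagawaNumber_partner_iff_dvd_of_one_mod_four_of_row`** — for `p ≡ 1 (mod 4)` (e.g. `p = 5`) and every place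
  `v ∤ p`: `p ∣ c_v(W) ⟺ p ∣ c_v(V)`; **`dvd_localTamagawaNumber_partner_iff_not_dvd_of_three_mod_four_of_row`** — for `p ≡ 3 (mod 4)` at a
  multiplicative `ℓ ≡ −1 (mod p)`: `p ∣ c_ℓ(W) ⟺ ¬ p ∣ c_ℓ(V)`.
So at `p = 5` the `ω⁰`- and `η`-branch Tamagawa obstructions of FINDING-19606-k8eta-c2-g11 §2d sit at the SAME places (the split multiplicative
primes of `V`), while at `p ≡ 3 (mod 4)` they swap at the inert multiplicative primes.

HONEST FRAMING (cell `bsd-potss`, run/shared/lean/pub/bsd-potss/; FULL-BSD rank ≤ 1 programme): TOOL THEOREMS ONLY (no definition, no named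
fact, no `sorry`, axioms standard). Nothing is booked; crux 19606 stays OPEN; `BSD(W, p)` is claimed for no pair. Seat `bsd-potss-k8eta-c2` g12
(prover), `--supports stmt-BirchSwinnertonDyer-19606`.

References: [SilvermanAEC2009] VII.5 Prop. 5.1 (b), X.2 Prop. 2.4 / Ex. 10.16, X.5 Cor. 5.4; [SilvermanATAEC1994] Cor. IV.9.2 (d);
[IrelandRosen1990] Ch. 5 §2 Thm. 1 (quadratic reciprocity, `(p*/ℓ) = (ℓ/p)`); [Serre1972] §2.2.
-/

set_option autoImplicit false
set_option linter.dupNamespace false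

noncomputable section

open scoped Classical NumberField

open NumberField IsDedekindDomain Field WeierstrassCurve Literature.NumberTheory.EllipticCurves
  Literature.NumberTheory.SerreUniformity Rat.HeightOneSpectrum Summit.BirchSwinnertonDyer.Rank1Residual
  Summit.BirchSwinnertonDyer.Rank1Residual.Additive

namespace Summit.BirchSwinnertonDyer.BirchSwinnertonDyer.Theorems.EtaCartanField

/-! ## §8 The splitting type of a `p*`-twist at an odd multiplicative prime `ℓ ≠ p` -/

/-- **`V = C • W^{(p*)}` is split at `ℓ` iff ((ℓ/p) = 1 ⟺ `W` is split at `ℓ`)**, for `W/ℚ` globally minimal elliptic, odd primes `ℓ ≠ p`, `W`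
multiplicative at `ℓ`: the unit twist by `d = p*` at `v = (ℓ)` is split iff (`d` is a square mod `ℓ` ⟺ `W` is split)
(`AdditivePotMult.hasMultiplicativeReductionAt_and_split_iff_quadraticTwist_of_not_dvd`), the splitting type is a `ℚ`-isomorphism invariant
(`hasSplitMultiplicativeReductionAtPrime_smul_iff`), and `(p*/ℓ) = (ℓ/p)` (`legendreSym_pStar`). [cite: SilvermanAEC2009, VII.5 Prop. 5.1(b) and X.5 Cor. 5.4]
[cite: IrelandRosen1990, Ch. 5 §2 Thm. 1] -/
theorem hasSplitMultiplicativeReductionAtPrime_iff_legendreSym_iff_of_twist_pStar (V : WeierstrassCurve ℚ) [V.IsElliptic]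
    (W : WeierstrassCurve ℚ) [W.IsElliptic] [W.IsGloballyMinimal] (C : VariableChange ℚ) (p : ℕ) [hp : Fact p.Prime] (hp2 : p ≠ 2)
    (hVW : C • W.quadraticTwist ((-1) ^ (p / 2) * p) = V) (ℓ : ℕ) [hℓ : Fact ℓ.Prime] (hℓ2 : ℓ ≠ 2) (hℓp : ℓ ≠ p)
    (hmult : W.HasMultiplicativeReductionAtPrime ℓ) :
    V.HasSplitMultiplicativeReductionAtPrime ℓ ↔ (legendreSym p ℓ = 1 ↔ W.HasSplitMultiplicativeReductionAtPrime ℓ) := by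
  obtain ⟨d, k, -, hdp, hdq⟩ := exists_pStar_eq p hp2
  have hdZ : d = (-1 : ℤ) ^ (p / 2) * p := by exact_mod_cast hdq
  rw [← hdq] at hVW
  -- the place `v` of `ℚ` at `ℓ`
  obtain ⟨v, rfl⟩ : ∃ v : HeightOneSpectrum (𝓞 ℚ), (primesEquiv v : ℕ) = ℓ :=
    ⟨primesEquiv.symm ⟨ℓ, hℓ.out⟩, by rw [Equiv.apply_symm_apply]⟩
  have hWv : W.HasMultiplicativeReductionAt v :=
    (hasMultiplicativeReductionAtPrime_iff_hasMultiplicativeReductionAt_ringOfIntegers W v).mp hmult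
  have hℓd : ¬ ((primesEquiv v : ℕ) : ℤ) ∣ d := by
    have h : ¬ ((primesEquiv v : ℕ) : ℤ) ∣ (p : ℤ) := fun h => hℓp
      ((Nat.prime_dvd_prime_iff_eq hℓ.out hp.out).mp (Int.natCast_dvd_natCast.mp h))
    rcases hdp with rfl | rfl
    · exact h
    · rwa [dvd_neg]
  obtain ⟨-, -, hsplit⟩ := AdditivePotMult.hasMultiplicativeReductionAt_and_split_iff_quadraticTwist_of_not_dvd W v hℓ2 hℓd hWv
  -- `V` split at `ℓ` iff `W^{(d)}` split at `v`
  have h1 : V.HasSplitMultiplicativeReductionAtPrime (primesEquiv v : ℕ) ↔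
      (W.quadraticTwist (d : ℚ)).HasSplitMultiplicativeReductionAt v := by
    have hd0 : (d : ℚ) ≠ 0 := by
      have : d ≠ 0 := fun h => hℓd (by rw [h]; exact dvd_zero _)
      exact_mod_cast this
    haveI := W.isElliptic_quadraticTwist hd0
    rw [← hVW, hasSplitMultiplicativeReductionAtPrime_smul_iff,
      hasSplitMultiplicativeReductionAtPrime_iff_hasSplitMultiplicativeReductionAt]
  -- `(d/ℓ) = (p*/ℓ) = (ℓ/p)` and `(d/ℓ) = 1 ⟺ d` is a square mod `ℓ`
  have h2 : IsSquare ((d : ℤ) : ZMod (primesEquiv v : ℕ)) ↔ legendreSym p (primesEquiv v : ℕ) = 1 := by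
    have hd0 : ((d : ℤ) : ZMod (primesEquiv v : ℕ)) ≠ 0 := by
      rw [Ne, ZMod.intCast_zmod_eq_zero_iff_dvd]; exact hℓd
    rw [← legendreSym.eq_one_iff (primesEquiv v : ℕ) hd0, hdZ, legendreSym_pStar hp2 hℓ2]
  rw [h1, hsplit, h2, hasSplitMultiplicativeReductionAtPrime_iff_hasSplitMultiplicativeReductionAt]

/-! ## §9 Rows of crux 19606: `(ℓ/p) = 1 ⟺ ℓ ≡ 1 (mod p) ∨ p ≡ 1 (mod 4)` -/

section Row

variable (V : WeierstrassCurve ℚ) [V.IsElliptic] [V.IsGloballyMinimal] (W : WeierstrassCurve ℚ) [W.IsElliptic] [W.IsGloballyMinimal]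
  (C : VariableChange ℚ) (p : ℕ) [hp : Fact p.Prime]

omit [V.IsElliptic] [V.IsGloballyMinimal] hp in
/-- For `(ℓ : 𝔽_p) = 1 ∨ (ℓ : 𝔽_p) = −1` (`p` odd): `(ℓ/p) = 1 ⟺ (ℓ : 𝔽_p) = 1 ∨ p ≡ 1 (mod 4)` (`(−1/p) = χ₄(p)`).
[cite: IrelandRosen1990, Ch. 5 §1 Prop. 5.1.2 Cor. 3] -/
theorem legendreSym_eq_one_iff_of_natCast_eq_one_or_eq_neg_one [Fact p.Prime] (hp2 : p ≠ 2) {ℓ : ℕ}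
    (hℓ : (ℓ : ZMod p) = 1 ∨ (ℓ : ZMod p) = -1) : legendreSym p ℓ = 1 ↔ ((ℓ : ZMod p) = 1 ∨ p % 4 = 1) := by
  have hodd : p % 2 = 1 := Nat.odd_iff.mp ((Fact.out : p.Prime).odd_of_ne_two hp2)
  rcases hℓ with h | h
  · have : legendreSym p ℓ = legendreSym p 1 := by
      unfold legendreSym; rw [Int.cast_natCast, h, Int.cast_one]
    rw [this, legendreSym.at_one]
    exact ⟨fun _ => Or.inl h, fun _ => rfl⟩
  · have : legendreSym p ℓ = legendreSym p (-1) := by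
      unfold legendreSym; rw [Int.cast_natCast, h, Int.cast_neg, Int.cast_one]
    rw [this, legendreSym.at_neg_one hp2, ZMod.χ₄_nat_eq_if_mod_four, if_neg (by omega)]
    have h1 : (ℓ : ZMod p) ≠ 1 := by
      rw [h]; intro h'
      have h2 : ((2 : ℕ) : ZMod p) = 0 := by
        rw [Nat.cast_ofNat]
        linear_combination -h'
      rw [ZMod.natCast_eq_zero_iff] at h2
      have := (Nat.prime_dvd_prime_iff_eq (Fact.out : p.Prime) Nat.prime_two).mp h2
      omega
    by_cases h4 : p % 4 = 1
    · rw [if_pos h4]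
      exact ⟨fun _ => Or.inr h4, fun _ => rfl⟩
    · rw [if_neg h4]
      constructor
      · intro h'; norm_num at h'
      · rintro (h' | h')
        · exact absurd h' h1
        · exact absurd h' h4

/-- **On a row, `(ℓ/p) = 1 ⟺ ℓ ≡ 1 (mod p) ∨ p ≡ 1 (mod 4)`** for every multiplicative prime `ℓ ≠ p` (since `ℓ ≡ ±1 (mod p)`,
`natCast_eq_one_or_eq_neg_one_of_hasMultiplicativeReduction_of_row`). [cite: Serre1972, §2.2] [cite: IrelandRosen1990, Ch. 5 §1] -/
theorem legendreSym_eq_one_iff_of_hasMultiplicativeReduction_of_row (hp5 : 5 ≤ p) (hgood : V.HasGoodReductionAtPrime p)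
    (hap : V.frobeniusTrace p = 0) (hns : ¬ ∀ m : ℕ, V.HasSurjectiveModNGaloisRep (p ^ m : ℕ)) (ℓ : ℕ) [Fact ℓ.Prime]
    (hℓp : ℓ ≠ p) (hmult : V.HasMultiplicativeReductionAtPrime ℓ) : legendreSym p ℓ = 1 ↔ ((ℓ : ZMod p) = 1 ∨ p % 4 = 1) :=
  legendreSym_eq_one_iff_of_natCast_eq_one_or_eq_neg_one p (by omega)
    (natCast_eq_one_or_eq_neg_one_of_hasMultiplicativeReduction_of_row V p hp5 hgood hap hns ℓ hℓp hmult)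

/-- **Splitting law of the partner.** On a row `V = C • W^{(p*)}` of crux 19606 (`V, W` globally minimal, `p ≥ 5` good for `V`, `a_p(V) = 0`,
tower not onto) and a multiplicative prime `ℓ ≠ p` (of `V`, equivalently of `W`): **`W` is split at `ℓ` iff (`V` is split at `ℓ` ⟺
(`ℓ ≡ 1 (mod p)` ∨ `p ≡ 1 (mod 4)`))**. [cite: SilvermanAEC2009, VII.5 Prop. 5.1(b) and X.5 Cor. 5.4] [cite: Serre1972, §2.2] -/
theorem hasSplitMultiplicativeReductionAtPrime_partner_iff_of_row (hp5 : 5 ≤ p) (hVW : C • W.quadraticTwist ((-1) ^ (p / 2) * p) = V)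
    (hgood : V.HasGoodReductionAtPrime p) (hap : V.frobeniusTrace p = 0) (hns : ¬ ∀ m : ℕ, V.HasSurjectiveModNGaloisRep (p ^ m : ℕ))
    (ℓ : ℕ) [Fact ℓ.Prime] (hℓp : ℓ ≠ p) (hmult : V.HasMultiplicativeReductionAtPrime ℓ) :
    W.HasSplitMultiplicativeReductionAtPrime ℓ ↔ (V.HasSplitMultiplicativeReductionAtPrime ℓ ↔ ((ℓ : ZMod p) = 1 ∨ p % 4 = 1)) := by
  have hp2 : p ≠ 2 := by omega
  have hℓ2 : ℓ ≠ 2 := by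
    have := le_add_one_of_hasMultiplicativeReduction_of_row V p hp5 hgood hap hns ℓ hℓp hmult
    omega
  obtain ⟨d, k, hdk, hdp, hdq⟩ := exists_pStar_eq p hp2
  have hmultW : W.HasMultiplicativeReductionAtPrime ℓ := by
    have hVW' : C • W.quadraticTwist (d : ℚ) = V := by rw [hdq]; exact hVW
    exact (mult_iff_of_twist_pStar p W hdk hdp C hVW' hℓp).mp hmult
  have h := hasSplitMultiplicativeReductionAtPrime_iff_legendreSym_iff_of_twist_pStar V W C p hp2 hVW ℓ hℓ2 hℓp hmultW
  rw [legendreSym_eq_one_iff_of_hasMultiplicativeReduction_of_row V p hp5 hgood hap hns ℓ hℓp hmult] at h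
  tauto

/-- **`p ≡ 1 (mod 4)`: the partner has the SAME splitting type as the row** at every multiplicative `ℓ ≠ p`.
[cite: SilvermanAEC2009, VII.5 Prop. 5.1(b) and X.5 Cor. 5.4] -/
theorem hasSplitMultiplicativeReductionAtPrime_partner_iff_of_one_mod_four_of_row (hp5 : 5 ≤ p) (hp4 : p % 4 = 1)
    (hVW : C • W.quadraticTwist ((-1) ^ (p / 2) * p) = V) (hgood : V.HasGoodReductionAtPrime p) (hap : V.frobeniusTrace p = 0)
    (hns : ¬ ∀ m : ℕ, V.HasSurjectiveModNGaloisRep (p ^ m : ℕ)) (ℓ : ℕ) [Fact ℓ.Prime] (hℓp : ℓ ≠ p)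
    (hmult : V.HasMultiplicativeReductionAtPrime ℓ) :
    W.HasSplitMultiplicativeReductionAtPrime ℓ ↔ V.HasSplitMultiplicativeReductionAtPrime ℓ := by
  rw [hasSplitMultiplicativeReductionAtPrime_partner_iff_of_row V W C p hp5 hVW hgood hap hns ℓ hℓp hmult]
  tauto

/-- **`p ≡ 3 (mod 4)` and `ℓ ≡ −1 (mod p)` (inert in `K_V`): the partner has the OPPOSITE splitting type** at `ℓ`.
[cite: SilvermanAEC2009, VII.5 Prop. 5.1(b) and X.5 Cor. 5.4] [cite: Serre1972, §2.2] -/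
theorem hasSplitMultiplicativeReductionAtPrime_partner_iff_not_of_three_mod_four_of_row (hp5 : 5 ≤ p) (hp4 : p % 4 = 3)
    (hVW : C • W.quadraticTwist ((-1) ^ (p / 2) * p) = V) (hgood : V.HasGoodReductionAtPrime p) (hap : V.frobeniusTrace p = 0)
    (hns : ¬ ∀ m : ℕ, V.HasSurjectiveModNGaloisRep (p ^ m : ℕ)) (ℓ : ℕ) [Fact ℓ.Prime] (hℓp : ℓ ≠ p)
    (hmult : V.HasMultiplicativeReductionAtPrime ℓ) (hℓ1 : (ℓ : ZMod p) = -1) :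
    W.HasSplitMultiplicativeReductionAtPrime ℓ ↔ ¬ V.HasSplitMultiplicativeReductionAtPrime ℓ := by
  haveI : NeZero p := ⟨(Fact.out : p.Prime).ne_zero⟩
  have h1 : (ℓ : ZMod p) ≠ 1 := by
    rw [hℓ1]; intro h'
    have h2 : ((2 : ℕ) : ZMod p) = 0 := by
      rw [Nat.cast_ofNat]
      linear_combination -h'
    rw [ZMod.natCast_eq_zero_iff] at h2
    have := (Nat.prime_dvd_prime_iff_eq (Fact.out : p.Prime) Nat.prime_two).mp h2
    omega
  rw [hasSplitMultiplicativeReductionAtPrime_partner_iff_of_row V W C p hp5 hVW hgood hap hns ℓ hℓp hmult]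
  constructor
  · intro h hV
    rcases h.mp hV with h' | h'
    · exact h1 h'
    · omega
  · intro h
    exact ⟨fun hV => absurd hV h, fun h' => by rcases h' with h' | h' <;> [exact absurd h' h1; omega]⟩

/-! ## §10 Tamagawa numbers of the row and of its partner -/

/-- **`p ≡ 1 (mod 4)` (e.g. `p = 5`): `p ∣ c_v(W) ⟺ p ∣ c_v(V)` at every finite place `v ∤ p`** — the `ω⁰`- and `η`-branch Tamagawa
obstructions of a row sit at the same places (the split multiplicative primes of `V`). [cite: SilvermanATAEC1994, Cor. IV.9.2 (d)]
[cite: SilvermanAEC2009, VII.5 Prop. 5.1(b) and X.5 Cor. 5.4] -/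
theorem dvd_localTamagawaNumber_partner_iff_dvd_of_one_mod_four_of_row (hp5 : 5 ≤ p) (hp4 : p % 4 = 1)
    (hVW : C • W.quadraticTwist ((-1) ^ (p / 2) * p) = V) (hgood : V.HasGoodReductionAtPrime p) (hap : V.frobeniusTrace p = 0)
    (hns : ¬ ∀ m : ℕ, V.HasSurjectiveModNGaloisRep (p ^ m : ℕ)) (v : HeightOneSpectrum (𝓞 ℚ)) (hvp : (primesEquiv v : ℕ) ≠ p) :
    p ∣ (W.baseChange (v.adicCompletion ℚ)).localTamagawaNumber (v.adicCompletionIntegers ℚ) ↔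
      p ∣ (V.baseChange (v.adicCompletion ℚ)).localTamagawaNumber (v.adicCompletionIntegers ℚ) := by
  haveI hℓ : Fact (primesEquiv v : ℕ).Prime := ⟨(primesEquiv v).2⟩
  rw [dvd_localTamagawaNumber_partner_iff_hasSplitMultiplicativeReductionAt_of_row V W C p hp5 hVW hgood hap hns v hvp,
    dvd_localTamagawaNumber_iff_hasSplitMultiplicativeReductionAt_of_row V p hp5 hgood hap hns v hvp,
    ← hasSplitMultiplicativeReductionAtPrime_iff_hasSplitMultiplicativeReductionAt W v,
    ← hasSplitMultiplicativeReductionAtPrime_iff_hasSplitMultiplicativeReductionAt V v]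
  by_cases hmult : V.HasMultiplicativeReductionAtPrime (primesEquiv v : ℕ)
  · exact hasSplitMultiplicativeReductionAtPrime_partner_iff_of_one_mod_four_of_row V W C p hp5 hp4 hVW hgood hap hns _ hvp hmult
  · -- neither curve is multiplicative at `v`
    have hp2 : p ≠ 2 := by omega
    obtain ⟨d, k, hdk, hdp, hdq⟩ := exists_pStar_eq p hp2
    have hVW' : C • W.quadraticTwist (d : ℚ) = V := by rw [hdq]; exact hVW
    have hmultW : ¬ W.HasMultiplicativeReductionAtPrime (primesEquiv v : ℕ) := fun h =>
      hmult ((mult_iff_of_twist_pStar p W hdk hdp C hVW' hvp).mpr h)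
    exact ⟨fun h => absurd h.hasMultiplicativeReductionAtPrime hmultW, fun h => absurd h.hasMultiplicativeReductionAtPrime hmult⟩

/-- **`p ≡ 3 (mod 4)` at an INERT multiplicative prime (`ℓ ≡ −1 (mod p)`): exactly one of `c_ℓ(V)`, `c_ℓ(W)` is divisible by `p`.**
[cite: SilvermanATAEC1994, Cor. IV.9.2 (d)] [cite: SilvermanAEC2009, VII.5 Prop. 5.1(b) and X.5 Cor. 5.4] -/
theorem dvd_localTamagawaNumber_partner_iff_not_dvd_of_three_mod_four_of_row (hp5 : 5 ≤ p) (hp4 : p % 4 = 3)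
    (hVW : C • W.quadraticTwist ((-1) ^ (p / 2) * p) = V) (hgood : V.HasGoodReductionAtPrime p) (hap : V.frobeniusTrace p = 0)
    (hns : ¬ ∀ m : ℕ, V.HasSurjectiveModNGaloisRep (p ^ m : ℕ)) (ℓ : ℕ) [hℓ : Fact ℓ.Prime] (hℓp : ℓ ≠ p)
    (hmult : V.HasMultiplicativeReductionAtPrime ℓ) (hℓ1 : (ℓ : ZMod p) = -1) {v : HeightOneSpectrum (𝓞 ℚ)}
    (hv : (primesEquiv v : ℕ) = ℓ) :
    p ∣ (W.baseChange (v.adicCompletion ℚ)).localTamagawaNumber (v.adicCompletionIntegers ℚ) ↔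
      ¬ p ∣ (V.baseChange (v.adicCompletion ℚ)).localTamagawaNumber (v.adicCompletionIntegers ℚ) := by
  subst hv
  have hvp : (primesEquiv v : ℕ) ≠ p := hℓp
  rw [dvd_localTamagawaNumber_partner_iff_hasSplitMultiplicativeReductionAt_of_row V W C p hp5 hVW hgood hap hns v hvp,
    dvd_localTamagawaNumber_iff_hasSplitMultiplicativeReductionAt_of_row V p hp5 hgood hap hns v hvp,
    ← hasSplitMultiplicativeReductionAtPrime_iff_hasSplitMultiplicativeReductionAt W v,
    ← hasSplitMultiplicativeReductionAtPrime_iff_hasSplitMultiplicativeReductionAt V v]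
  exact hasSplitMultiplicativeReductionAtPrime_partner_iff_not_of_three_mod_four_of_row V W C p hp5 hp4 hVW hgood hap hns _ hvp
    hmult hℓ1

end Row

end Summit.BirchSwinnertonDyer.BirchSwinnertonDyer.Theorems.EtaCartanField

end
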